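import Summits.AtomisticToContinuum.HydrodynamicLimit.Theses.TwoClocks
import Summits.AtomisticToContinuum.HydrodynamicLimit.Theorems.TwoClocksEntropyToHydro

/-!
# Route TwoClocks — the `Assembly` frame: reductions (rev-4 module, transcribed to rev 10)

History. This module was written for the rev-4 frame `Assembly` = item
stmt-AtomisticToContinuum-13805 (`KineticWindowLDUniform → EquilibriumClampedCollisionalWindowLD →
EnergyCurrentTails → CollisionActivityTails → UniformLocalGibbsConcentration → HsEosLowDensity →
DiluteSelfConsistency → HydrodynamicLimit`) and recorded three pure-logic reductions of it:
`assembly_of_clampedWindowDock : ClampedWindowDock → Assembly` (through the dock support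
stmt-AtomisticToContinuum-13735, the seven inputs → `RelEntropyVanishing`, and the landed
entropy-inequality glue `entropyToHydro_proof`, stmt-AtomisticToContinuum-0769),
`assembly_of_relEntropyVanishing : RelEntropyVanishing → Assembly` (through the same glue), and the
vacuity record `assembly_of_not_equilibriumClampedCollisionalWindowLD :
¬ EquilibriumClampedCollisionalWindowLD → Assembly` (the second antecedent stmt-13733 being refuted in
Lean). Route revision 10 (2026-08-16T20:17:18Z, after that refutation) DROPPED `ClampedWindowDock`
(stmt-13735), REPLACED `EquilibriumClampedCollisionalWindowLD` (stmt-13733 → `ClampedTransferWindowLD`,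
stmt-16623) and `CollisionActivityTails` (stmt-13734 → `TransferActivityTails`, stmt-16624), and
RESTATED the frame: `Assembly` is now item stmt-AtomisticToContinuum-16626,
`KineticWindowLDUniform → ClampedTransferWindowLD → EnergyCurrentTails → TransferActivityTails →
UniformLocalGibbsConcentration → HsEosLowDensity → DiluteSelfConsistency → HydrodynamicLimit`
(the retired items are kept as records in the route file); the sub-problem Statement was re-typed the
same day (D-0032: `_root_.HydrodynamicLimit` is the packing-guarded conjunct, reached from the
unguarded Literature conjecture by the Statement file's bridge `HydrodynamicLimit.of_unguarded`).

Transcription to rev 10 over the repaired items (Theorems files are append-only: the two rev-4 names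
whose hypotheses no longer exist survive as deprecated aliases of their transcriptions; the two
original imports are kept):

* `assembly_of_relEntropyVanishing : RelEntropyVanishing → Assembly` — unchanged name and statement:
  a direct proof of the shared entropy target (stmt-AtomisticToContinuum-0766) closes the frame with
  all seven antecedents idle, by the glue `entropyToHydro_proof` and the bridge
  `HydrodynamicLimit.of_unguarded`;
* `assembly_of_relEntropyDock` (deprecated alias `assembly_of_clampedWindowDock`) — an entropy-target
  dock closes the frame: if the seven rev-10 inputs give `RelEntropyVanishing` (the shape of the
  dropped dock support stmt-13735 written out over the repaired collisional pair; a hypothesis, not a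
  route item), then `Assembly`;
* `assembly_of_not_clampedTransferWindowLD` (deprecated alias
  `assembly_of_not_equilibriumClampedCollisionalWindowLD`) — the vacuity record for the repaired
  second antecedent: `¬ ClampedTransferWindowLD → Assembly`.

The other rev-10 reductions of the frame — `twoClocksAssembly_of_transferEntropyClock :
TransferEntropyClock → Assembly` (the rev-10 dock is crux 11, stmt-AtomisticToContinuum-16625),
`twoClocksAssembly_of_hydrodynamicLimit` and the five-way vacuity record
`twoClocksAssembly_of_not_input` — live in `TwoClocksAssemblyReductions.lean`.
-/

namespace Summit.AtomisticToContinuum.HydrodynamicLimit.Theorems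

open Summit.AtomisticToContinuum.HydrodynamicLimit.Theses.TwoClocks

/-- **The entropy target closes the frame.** If the shared typed target `RelEntropyVanishing`
(stmt-AtomisticToContinuum-0766: `o(N)` relative entropy of the law at time `t` with respect to a
reference local Gibbs law whose fields concentrate exponentially around the Euler fields) holds
outright, then `Assembly` (rev 10, stmt-AtomisticToContinuum-16626) holds with its seven antecedents
idle: the landed glue `entropyToHydro_proof : EntropyToHydro` yields the unguarded Literature
conjecture `Literature.MathematicalPhysics.KineticTheory.HydrodynamicLimit`, and the Statement file's
bridge `HydrodynamicLimit.of_unguarded` the packing-guarded conjunct `_root_.HydrodynamicLimit` that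
the frame concludes. [cite: Yau1991, §2] [cite: OllaVaradhanYau1993, §3] -/
theorem assembly_of_relEntropyVanishing (hRE : RelEntropyVanishing) : Assembly := by
  unfold Assembly
  intro _ _ _ _ _ _ _
  exact _root_.HydrodynamicLimit.of_unguarded (entropyToHydro_proof hRE)

/-- **An entropy-target dock closes the frame.** If the seven rev-10 inputs of `Assembly` dock into
the shared entropy target — `KineticWindowLDUniform → ClampedTransferWindowLD → TransferActivityTails
→ EnergyCurrentTails → UniformLocalGibbsConcentration → HsEosLowDensity → DiluteSelfConsistency →
RelEntropyVanishing` (Yau's relative-entropy Gronwall run with window-averaged clamped currents; the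
shape of the dropped rev-4 dock support `ClampedWindowDock`, stmt-AtomisticToContinuum-13735, over the
repaired collisional pair stmt-16623 / stmt-16624; a hypothesis here, not a route item) — then
`Assembly` (stmt-AtomisticToContinuum-16626) holds: feed the seven inputs to the dock (note the swapped
order of the two tail inputs) and finish with `assembly_of_relEntropyVanishing` (glue
`entropyToHydro_proof`, stmt-AtomisticToContinuum-0769, and bridge `HydrodynamicLimit.of_unguarded`).
[cite: Yau1991, §2] [cite: KipnisLandim1999, Ch. 6 §1] -/
theorem assembly_of_relEntropyDock
    (hD : KineticWindowLDUniform → ClampedTransferWindowLD → TransferActivityTails →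
      EnergyCurrentTails → UniformLocalGibbsConcentration → HsEosLowDensity → DiluteSelfConsistency →
      RelEntropyVanishing) : Assembly := by
  unfold Assembly
  intro hK h₃ h₆ h₇ hU hE hS
  exact _root_.HydrodynamicLimit.of_unguarded (entropyToHydro_proof (hD hK h₃ h₇ h₆ hU hE hS))

/-- **The dock closes the frame** — DEPRECATED rev-4 name. Its hypothesis `ClampedWindowDock`
(stmt-AtomisticToContinuum-13735) was dropped by route revision 10 (2026-08-16T20:17:18Z); the
transcription over the repaired items is `assembly_of_relEntropyDock`, of which this is an alias (the
rev-10 dock proper is crux 11 `TransferEntropyClock`, see `twoClocksAssembly_of_transferEntropyClock`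
in `TwoClocksAssemblyReductions.lean`). [folklore] -/
@[deprecated assembly_of_relEntropyDock (since := "2026-08-17")]
alias assembly_of_clampedWindowDock := assembly_of_relEntropyDock

/-- **A refuted second antecedent closes the frame (vacuity record).** The rev-4 second antecedent
`EquilibriumClampedCollisionalWindowLD` (stmt-AtomisticToContinuum-13733) was refuted in Lean
(Newton-cradle energy relay against the momentum-only activity clamp;
`TwoClocksEquilibriumClampedCollisionalWindowLDRefutation.lean`) and replaced in rev 10 by the
transfer-clamped crux `ClampedTransferWindowLD` (stmt-AtomisticToContinuum-16623), again the SECOND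
antecedent of `Assembly`: a sorry-free `¬ ClampedTransferWindowLD` would close the frame
(stmt-AtomisticToContinuum-16626) ex falso by this term — and would, as in rev 4, send the frame back
to the planner for restatement rather than credit it. General form: `twoClocksAssembly_of_not_input`
(`TwoClocksAssemblyReductions.lean`; any of the five open antecedents). [folklore] -/
theorem assembly_of_not_clampedTransferWindowLD (hneg : ¬ ClampedTransferWindowLD) : Assembly := by
  unfold Assembly
  intro _ h₃
  exact absurd h₃ hneg

/-- **A refuted antecedent closes the frame** — DEPRECATED rev-4 name. Its hypothesis
`¬ EquilibriumClampedCollisionalWindowLD` concerned the rev-4 second antecedent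
(stmt-AtomisticToContinuum-13733, refuted and replaced in rev 10 by `ClampedTransferWindowLD`,
stmt-AtomisticToContinuum-16623); the transcription is `assembly_of_not_clampedTransferWindowLD`, of
which this is an alias. [folklore] -/
@[deprecated assembly_of_not_clampedTransferWindowLD (since := "2026-08-17")]
alias assembly_of_not_equilibriumClampedCollisionalWindowLD := assembly_of_not_clampedTransferWindowLD

end Summit.AtomisticToContinuum.HydrodynamicLimit.Theorems
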